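import Literature.NumberTheory.FaltingsSerre.CertificateTransfer
import Literature.NumberTheory.FaltingsSerre.GSp4F2Iso
import HarnessLib

/-!
# Certificates along a residual conjugacy (transport of Steps 2–4 between frames)

[BPPTVY] = A. Brumer, A. Pacetti, C. Poor, G. Tornaría, J. Voight, D. S. Yuen, *On the paramodularity of
typical abelian surfaces*, Algebra & Number Theory **13**:5 (2019) 1145–1195 [cite: BrumerEtAl2019].

`CertificateTransfer.lean` moves the class-field block (Steps 2–4 of [BPPTVY, Algorithm 2.4.1 p. 1156],
the field `Certificate.complete`) and absolute irreducibility from a certified pair `(ρ₁, ρ₂)` to a second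
pair `(ρ₁', ρ₂')` whose first residual representation is EQUAL to `ρ̄₁`.  In practice (two abelian
surfaces with the same `2`-division field, [BPPTVY, §7.3 p. 1191]: `C₅₈₇⁺`, `C₅₈₇⁻`) the two first members
come with their OWN frames, and a certificate producer can only establish that `ρ̄₁'` is CONJUGATE to
`ρ̄₁` — by a symplectic residual matrix `ḡ`, `ḡᵀ J̄ ḡ = J̄` (for `GSp₄(𝔽₂) = ι(S₆)`: `ḡ = ι(π)`, cf.
`ResidualRigidity.lean`).  This file proves that this is enough:

* `IsAbsIrreducible.of_conj` — absolute irreducibility of `σ : Γ → GL_n(k)` is invariant under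
  `σ ↦ g σ g⁻¹` (the conjugating matrix intertwines the two representations after any scalar
  extension; Mathlib `Representation.Equiv`, `IsSimpleModule.congr`);
* `complete_of_conj` — the Steps 2–4 predicate "every locally constant deviation cocycle of `ρ̄`,
  vanishing on `I`, valued in `𝔰𝔭(J̄)` and obstructing, is obstructing at an element of `F`" passes from
  `ρ̄` to `ḡ ρ̄ ḡ⁻¹` for `ḡ` symplectic: the cocycle `μ` of `ḡ ρ̄ ḡ⁻¹` is pulled back to the cocycle
  `ḡ⁻¹ μ ḡ` of `ρ̄` ([BPPTVY, (2.3.3) p. 1153]: `μ(στ) = μ(σ) + ρ̄(σ) μ(τ) ρ̄(σ)⁻¹`), which is again valued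
  in `𝔰𝔭(J̄)` because `ḡ` is symplectic, and has the same obstruction traces
  `tr(ḡ⁻¹ μ(σ) ḡ · ρ̄(σ)) = tr(μ(σ) · ḡ ρ̄(σ) ḡ⁻¹)` ([BPPTVY, Def. 2.3.18 p. 1155]);
* `Certificate.ofResidualConj`, `SurfaceCertificate.ofResidualConj` and the `ι(S₆)` form
  `SurfaceCertificate.ofResidualConjPerm` — the transfer constructors: a certificate for `(ρ₁, ρ₂)`, a
  symplectic `ḡ` with `ρ̄₁' = ḡ ρ̄₁ ḡ⁻¹`, and Step 1 / Step 5 / the side conditions for `(ρ₁', ρ₂')` give a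
  certificate for `(ρ₁', ρ₂')` with the SAME check places.

No new cited fact; kernel-checked bookkeeping over the schema of `ParamodularCertificate.lean`.
-/

namespace Literature.NumberTheory.FaltingsSerre

open Matrix Field IsDedekindDomain Equiv
open Literature.NumberTheory.GaloisRepresentations
open scoped NumberField

/-! ### A. Absolute irreducibility is a conjugacy invariant -/

section AbsIrr

variable {Γ : Type*} [Group Γ] {k : Type*} [Field k] {n : ℕ}

/-- **Absolute irreducibility is invariant under conjugation**: if `σ' = g σ g⁻¹` and `σ` is absolutely
irreducible then so is `σ'` (for every scalar extension `f : k → k'`, `v ↦ f(g) v` is an isomorphism of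
the two representations on `k'ⁿ`). [folklore] Ref: Curtis–Reiner (1962), §29. -/
theorem _root_.Literature.NumberTheory.GaloisRepresentations.IsAbsIrreducible.of_conj
    (σ σ' : Γ →* GL (Fin n) k) (g : GL (Fin n) k) (h : ∀ γ, σ' γ = g * σ γ * g⁻¹)
    (hσ : IsAbsIrreducible σ) : IsAbsIrreducible σ' := by
  intro k' _ f
  have hirr := hσ k' f
  -- the intertwining operator `v ↦ f(g) v`
  let e : (Fin n → k') ≃ₗ[k'] (Fin n → k') :=
    { toFun := fun v => ((Matrix.GeneralLinearGroup.map f g : GL (Fin n) k') :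
          Matrix (Fin n) (Fin n) k') *ᵥ v
      map_add' := fun v w => Matrix.mulVec_add _ _ _
      map_smul' := fun c v => Matrix.mulVec_smul _ _ _
      invFun := fun v => (((Matrix.GeneralLinearGroup.map f g)⁻¹ : GL (Fin n) k') :
          Matrix (Fin n) (Fin n) k') *ᵥ v
      left_inv := fun v => by
        simp only [Matrix.mulVec_mulVec, Units.inv_mul, Matrix.one_mulVec]
      right_inv := fun v => by
        simp only [Matrix.mulVec_mulVec, Units.mul_inv, Matrix.one_mulVec] }
  have he_apply : ∀ v, e v = ((Matrix.GeneralLinearGroup.map f g : GL (Fin n) k') :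
      Matrix (Fin n) (Fin n) k') *ᵥ v := fun v => rfl
  have he : ∀ γ, (e : (Fin n → k') →ₗ[k'] (Fin n → k')) ∘ₗ
        (glRepresentation ((Matrix.GeneralLinearGroup.map f).comp σ) γ) =
      (glRepresentation ((Matrix.GeneralLinearGroup.map f).comp σ') γ) ∘ₗ
        (e : (Fin n → k') →ₗ[k'] (Fin n → k')) := by
    intro γ
    apply LinearMap.ext
    intro v
    rw [LinearMap.comp_apply, LinearMap.comp_apply, LinearEquiv.coe_coe, he_apply, he_apply,
      glRepresentation_apply_apply, glRepresentation_apply_apply, MonoidHom.comp_apply,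
      MonoidHom.comp_apply, h γ, map_mul, map_mul, map_inv, Units.val_mul, Units.val_mul,
      Matrix.mulVec_mulVec, Matrix.mulVec_mulVec, Units.inv_mul_cancel_right]
  let φ := Representation.Equiv.mk e he
  rw [Representation.irreducible_iff_isSimpleModule_asModule] at hirr ⊢
  haveI := hirr
  exact IsSimpleModule.congr (LinearEquiv.ofBijective
    (Representation.IntertwiningMap.equivLinearMapAsModule _ _ φ.symm.toIntertwiningMap)
    φ.symm.toLinearEquiv.bijective)

end AbsIrr

/-! ### B. Steps 2–4 along a symplectic conjugacy -/

section Complete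

variable {Γ : Type*} [Group Γ] [TopologicalSpace Γ] {k : Type*} [CommRing k] {n : ℕ}

/-- **Transport of the Steps 2–4 predicate along `ρ̄ ↦ ḡ ρ̄ ḡ⁻¹`, `ḡ` symplectic for `J̄`.**  The
cocycle `μ` for `ḡ ρ̄ ḡ⁻¹` pulls back to the cocycle `σ ↦ ḡ⁻¹ μ(σ) ḡ` for `ρ̄`, with the same support,
again valued in `𝔰𝔭(J̄)`, and with the same obstruction traces. [cite: BrumerEtAl2019, (2.3.3) p. 1153, Def. 2.3.18 p. 1155, Algorithm 2.4.1 Steps 2–4 p. 1156] -/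
theorem complete_of_conj (ρbar ρbar' : Γ →* GL (Fin n) k) (Jbar : Matrix (Fin n) (Fin n) k)
    (g : GL (Fin n) k) (hg : (g : Matrix (Fin n) (Fin n) k)ᵀ * Jbar * g = Jbar)
    (h : ∀ γ, ρbar' γ = g * ρbar γ * g⁻¹) (I F : Set Γ)
    (hc : ∀ μ : Γ → Matrix (Fin n) (Fin n) k, IsLocallyConstant μ → (∀ σ ∈ I, μ σ = 0) →
      ValuedIn (spLie Jbar) μ → IsDeviationCocycle ρbar μ → IsObstructing ρbar μ →
      ∃ σ ∈ F, IsObstructingElt ρbar μ σ) :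
    ∀ μ : Γ → Matrix (Fin n) (Fin n) k, IsLocallyConstant μ → (∀ σ ∈ I, μ σ = 0) →
      ValuedIn (spLie Jbar) μ → IsDeviationCocycle ρbar' μ → IsObstructing ρbar' μ →
      ∃ σ ∈ F, IsObstructingElt ρbar' μ σ := by
  intro μ hlc hI hV hdev hob
  -- the pulled-back cocycle, in the frame of `ρbar`
  set μ₀ : Γ → Matrix (Fin n) (Fin n) k := fun σ =>
    ((g⁻¹ : GL (Fin n) k) : Matrix (Fin n) (Fin n) k) * μ σ * (g : Matrix (Fin n) (Fin n) k)
    with hμ₀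
  -- `ḡ` symplectic: `J̄ ḡ⁻¹ = ḡᵀ J̄` and `(ḡ⁻¹)ᵀ J̄ = J̄ ḡ`
  have e1 : Jbar * ((g⁻¹ : GL (Fin n) k) : Matrix (Fin n) (Fin n) k) =
      (g : Matrix (Fin n) (Fin n) k)ᵀ * Jbar := by
    conv_lhs => rw [← hg]
    rw [Units.mul_inv_cancel_right]
  have e2 : ((g⁻¹ : GL (Fin n) k) : Matrix (Fin n) (Fin n) k)ᵀ * Jbar =
      Jbar * (g : Matrix (Fin n) (Fin n) k) := by
    conv_lhs => rw [← hg]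
    rw [← Matrix.mul_assoc, ← Matrix.mul_assoc, ← Matrix.transpose_mul, Units.mul_inv,
      Matrix.transpose_one, Matrix.one_mul]
  -- same obstruction traces
  have htr : ∀ σ, Matrix.trace (μ₀ σ * (ρbar σ : Matrix (Fin n) (Fin n) k)) =
      Matrix.trace (μ σ * (ρbar' σ : Matrix (Fin n) (Fin n) k)) := by
    intro σ
    rw [h σ, Units.val_mul, Units.val_mul, hμ₀]
    simp only [Matrix.mul_assoc]
    rw [Matrix.trace_mul_comm]
    simp only [Matrix.mul_assoc]
  have hlc₀ : IsLocallyConstant μ₀ :=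
    hlc.comp fun M => ((g⁻¹ : GL (Fin n) k) : Matrix (Fin n) (Fin n) k) * M *
      (g : Matrix (Fin n) (Fin n) k)
  have hI₀ : ∀ σ ∈ I, μ₀ σ = 0 := fun σ hσ => by
    simp only [hμ₀, hI σ hσ, Matrix.mul_zero, Matrix.zero_mul]
  have hV₀ : ValuedIn (spLie Jbar) μ₀ := by
    intro σ
    have hσ := hV σ
    simp only [spLie, Set.mem_setOf_eq] at hσ ⊢
    have key : (((g⁻¹ : GL (Fin n) k) : Matrix (Fin n) (Fin n) k) * μ σ *
          (g : Matrix (Fin n) (Fin n) k))ᵀ * Jbar +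
        Jbar * (((g⁻¹ : GL (Fin n) k) : Matrix (Fin n) (Fin n) k) * μ σ *
          (g : Matrix (Fin n) (Fin n) k)) =
        (g : Matrix (Fin n) (Fin n) k)ᵀ * ((μ σ)ᵀ * Jbar + Jbar * μ σ) *
          (g : Matrix (Fin n) (Fin n) k) := by
      rw [Matrix.transpose_mul, Matrix.transpose_mul, Matrix.mul_add, Matrix.add_mul]
      congr 1
      · simp only [Matrix.mul_assoc, e2]
      · rw [← Matrix.mul_assoc, ← Matrix.mul_assoc, e1]
        simp only [Matrix.mul_assoc]
    rw [hμ₀]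
    rw [key, hσ, Matrix.mul_zero, Matrix.zero_mul]
  have hdev₀ : IsDeviationCocycle ρbar μ₀ := by
    intro σ τ
    simp only [hμ₀]
    rw [hdev σ τ, h σ, _root_.mul_inv_rev, _root_.mul_inv_rev, inv_inv]
    simp only [Units.val_mul, Matrix.mul_add, Matrix.add_mul, Matrix.mul_assoc,
      Units.inv_mul_cancel_left, Units.inv_mul, Matrix.mul_one]
  have hob₀ : IsObstructing ρbar μ₀ := by
    rw [isObstructing_iff] at hob ⊢
    obtain ⟨σ, hσ⟩ := hob
    refine ⟨σ, ?_⟩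
    unfold IsObstructingElt at hσ ⊢
    rw [htr]
    exact hσ
  obtain ⟨σ, hσF, hE⟩ := hc μ₀ hlc₀ hI₀ hV₀ hdev₀ hob₀
  refine ⟨σ, hσF, ?_⟩
  unfold IsObstructingElt at hE ⊢
  rw [← htr]
  exact hE

end Complete

/-! ### C. Transfer constructors -/

section Transfer

variable {K : Type} [Field K] {ℓ : ℕ} [Fact ℓ.Prime] {n : ℕ}
  {S P : Set (HeightOneSpectrum (𝓞 K))} {J : Matrix (Fin n) (Fin n) ℤ_[ℓ]}
  {ν : absoluteGaloisGroup K → ℤ_[ℓ]} {ρ₁ ρ₂ ρ₁' ρ₂' : FramedGaloisRep K ℤ_[ℓ] n}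

/-- **Certificates with a CONJUGATE residual representation.**  A certificate for `(ρ₁, ρ₂)`, a residual
matrix `ḡ` symplectic for `J̄ = J mod ℓ` with `ρ̄₁' = ḡ ρ̄₁ ḡ⁻¹`, plus Step 1 (`ρ̄₂' = ρ̄₁'`), Step 5 and
the side conditions for `(ρ₁', ρ₂')`, is a certificate for `(ρ₁', ρ₂')` with the SAME sets `S`, `P`:
Steps 2–4 and absolute irreducibility are transported along the conjugacy (`complete_of_conj`,
`IsAbsIrreducible.of_conj`). [cite: BrumerEtAl2019, Algorithm 2.4.1 p. 1156; §7.3 p. 1191] -/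
theorem Certificate.ofResidualConj (C : Certificate S P J ν ρ₁ ρ₂) (g : GL (Fin n) (ZMod ℓ))
    (hg : (g : Matrix (Fin n) (Fin n) (ZMod ℓ))ᵀ * J.map (PadicInt.toZMod (p := ℓ)) * g =
      J.map (PadicInt.toZMod (p := ℓ)))
    (h₁ : ∀ σ, residual ρ₁'.toMonoidHom σ = g * residual ρ₁.toMonoidHom σ * g⁻¹)
    (h₂ : residual ρ₂'.toMonoidHom = residual ρ₁'.toMonoidHom)
    (hs₁ : ∀ σ, IsSimilitude J (ν σ) ((ρ₁' σ : GL (Fin n) ℤ_[ℓ]) : Matrix (Fin n) (Fin n) ℤ_[ℓ]))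
    (hs₂ : ∀ σ, IsSimilitude J (ν σ) ((ρ₂' σ : GL (Fin n) ℤ_[ℓ]) : Matrix (Fin n) (Fin n) ℤ_[ℓ]))
    (hu₁ : ∀ v ∉ S, ρ₁'.IsUnramifiedAt v) (hu₂ : ∀ v ∉ S, ρ₂'.IsUnramifiedAt v)
    (ht : ∀ σ ∈ frobeniusAt K P, FramedRep.trace ρ₁' σ = FramedRep.trace ρ₂' σ) :
    Certificate S P J ν ρ₁' ρ₂' where
  det_isUnit := C.det_isUnit
  transpose_eq := C.transpose_eq
  diag_eq := C.diag_eq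
  similitude₁ := hs₁
  similitude₂ := hs₂
  residual_eq := h₂.symm
  absIrreducible := IsAbsIrreducible.of_conj _ _ g h₁ C.absIrreducible
  unramified₁ := hu₁
  unramified₂ := hu₂
  complete := complete_of_conj _ _ _ g hg h₁ _ _ C.complete
  traces := ht

end Transfer

/-! ### D. Surface form (`K = ℚ`, `ℓ = 2`, `n = 4`) -/

section Surface

variable {N : ℕ} {T : Finset ℕ} {J : Matrix (Fin 4) (Fin 4) ℤ_[2]}
  {ν : absoluteGaloisGroup ℚ → ℤ_[2]} {ρA ρf ρA' ρf' : FramedGaloisRep ℚ ℤ_[2] 4}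

/-- **Level-`N` surface certificates with conjugate residual representations.**  As
`SurfaceCertificate.ofResidualEq`, with `residual ρA' = ḡ (residual ρA) ḡ⁻¹` for a residual matrix
`ḡ` symplectic for `J̄` in place of equality. [cite: BrumerEtAl2019, Algorithm 2.4.1 p. 1156; Thm 7.3.1 p. 1191] -/
theorem SurfaceCertificate.ofResidualConj (C : SurfaceCertificate N T J ν ρA ρf)
    (g : GL (Fin 4) (ZMod 2))
    (hg : (g : Matrix (Fin 4) (Fin 4) (ZMod 2))ᵀ * J.map (PadicInt.toZMod (p := 2)) * g =
      J.map (PadicInt.toZMod (p := 2)))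
    (h₁ : ∀ σ, residual ρA'.toMonoidHom σ = g * residual ρA.toMonoidHom σ * g⁻¹)
    (h₂ : residual ρf'.toMonoidHom = residual ρA'.toMonoidHom)
    (hs₁ : ∀ σ, IsSimilitude J (ν σ) ((ρA' σ : GL (Fin 4) ℤ_[2]) : Matrix (Fin 4) (Fin 4) ℤ_[2]))
    (hs₂ : ∀ σ, IsSimilitude J (ν σ) ((ρf' σ : GL (Fin 4) ℤ_[2]) : Matrix (Fin 4) (Fin 4) ℤ_[2]))
    (hu₁ : ∀ v ∉ placesOver (badPrimes N), ρA'.IsUnramifiedAt v)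
    (hu₂ : ∀ v ∉ placesOver (badPrimes N), ρf'.IsUnramifiedAt v)
    (ht : ∀ σ ∈ frobeniusAt ℚ (placesOver T), FramedRep.trace ρA' σ = FramedRep.trace ρf' σ) :
    SurfaceCertificate N T J ν ρA' ρf' :=
  Certificate.ofResidualConj C g hg h₁ h₂ hs₁ hs₂ hu₁ hu₂ ht

/-- **The `ι(S₆)` form**: when `J̄` is the anti-identity (the Gram matrix of `GSp₄(𝔽₂) = ι(S₆)`,
[BPPTVY, (5.1.2) p. 1173]) and `residual ρA' = ι(π) (residual ρA) ι(π)⁻¹` for a permutation `π ∈ S₆` (the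
output of the residual rigidity theorems of `ResidualRigidity.lean` applied to the two surfaces), the
symplectic condition on `ḡ = ι(π)` is automatic (`GSp4F2.mem_range_iotaGL`). [cite: BrumerEtAl2019, (5.1.1)–(5.1.2) p. 1173; Thm 7.3.1 p. 1191] -/
theorem SurfaceCertificate.ofResidualConjPerm (C : SurfaceCertificate N T J ν ρA ρf)
    (hJ : J.map (PadicInt.toZMod (p := 2)) = antiId4 (ZMod 2)) (π : Perm (Fin 6))
    (h₁ : ∀ σ, residual ρA'.toMonoidHom σ =
      GSp4F2.iotaGL π * residual ρA.toMonoidHom σ * (GSp4F2.iotaGL π)⁻¹)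
    (h₂ : residual ρf'.toMonoidHom = residual ρA'.toMonoidHom)
    (hs₁ : ∀ σ, IsSimilitude J (ν σ) ((ρA' σ : GL (Fin 4) ℤ_[2]) : Matrix (Fin 4) (Fin 4) ℤ_[2]))
    (hs₂ : ∀ σ, IsSimilitude J (ν σ) ((ρf' σ : GL (Fin 4) ℤ_[2]) : Matrix (Fin 4) (Fin 4) ℤ_[2]))
    (hu₁ : ∀ v ∉ placesOver (badPrimes N), ρA'.IsUnramifiedAt v)
    (hu₂ : ∀ v ∉ placesOver (badPrimes N), ρf'.IsUnramifiedAt v)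
    (ht : ∀ σ ∈ frobeniusAt ℚ (placesOver T), FramedRep.trace ρA' σ = FramedRep.trace ρf' σ) :
    SurfaceCertificate N T J ν ρA' ρf' :=
  SurfaceCertificate.ofResidualConj C (GSp4F2.iotaGL π)
    (by rw [hJ]; exact (GSp4F2.mem_range_iotaGL _).1 (MonoidHom.mem_range.2 ⟨π, rfl⟩)) h₁ h₂ hs₁ hs₂
    hu₁ hu₂ ht

end Surface

end Literature.NumberTheory.FaltingsSerre
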